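import Summits.BirchSwinnertonDyer.Rank1Residual.Additive.TameBranchAnalyticShaOddPrime
import HarnessLib

/-!
# `BSD(E,p)` ⟺ THE MAIN CONJECTURE AT THE PAIR AT EVERY ODD `p`, `p = 3` INCLUDED — X4♯(G-ord, `e = 2`)
# ∩ {`ρ̄` onto}, rank 0, (B)-datum a binder: `BSD(E,p)` ⟹ the Kato element generates and `ℓ = 1`;
# MC(pair) ⟹ `BSD(E,p)` off the anomalous rows; a LOWER bound on `#Ш[p^∞]` closes the chain
# (cell `b2b-bsdres`, sub-cell additive-p2 = X3♯(G-ord)/X4♯(G-ord), gen 33; part 2)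

HONEST FRAMING (cell `b2b-bsdres`, run/shared/lean/b2b/bsd-rank1-residual/, verbatim in every
file): the goal of the cell is to DELETE the COMBINATION-SHAPED residual classes of the
Birch–Swinnerton-Dyer formula for ALL analytic-rank `≤ 1` elliptic curves over `ℚ` — "full BSD
formula for every rank `≤ 1` curve in class `C`" assembled STRICTLY from published theorems — so
that the rank-`≤ 1` remainder becomes exactly the CONSTRUCTION-SHAPED classes, which are TYPED
(missing-input `Prop`s), NOT attempted. This is not "finishing BSD". Sub-cell additive-p2: the
classes X3♯(G-ord) / X4♯(G-ord) are CONSTRUCTION-SHAPED and stay so; labels / RESIDUAL-MAP marks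
UNCHANGED; nothing is booked (`BSD(E,p)` and the lower bound enter ONLY as hypotheses). Theorems only;
published inputs are explicit binders (`hK` Kato 2004 Thm. 17.4 (3), `hGZK`, `hmod`, the (B)-datum
`LeadingTermClauses W p Dh` — A175 at `p ≥ 5`, `mainTheorem_three` at `p = 3`). No definition, no named
fact, no `sorry`.

## What and why

Part 1 (`TameBranchAnalyticShaOddPrime.lean`) proved gen 32's MASTER theorem at every odd `p` with the
(B)-datum a binder: on X4♯(G-ord) ∩ {`ρ̄_{E,p}` onto}, `r_an = 0`, for the twist datum `(V, C, f, ϖ)` and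
every cyclotomic dual datum, the Kato element `g` and Delbourgo's `ℓ ∣ p²` satisfy
`ord_p #Ш[p^∞] + ord_p ℓ ≤ ord_p #Ш_an`, `=` ⟺ `char_Λ X = (g)`. THIS FILE is gen 32's part 6 §2 at
every odd `p` (so at `p = 3`): (c) **`BSD(E,p)` ⟹ `char_Λ X = (g)` AND every admissible `ℓ' = 1`**
(`ClassX4Gord.charIdeal_eq_span_kato_of_bsdp_rankZero_odd`); (d) **off the anomalous rows MC(pair) ⟹
`BSD(E,p)`** (`…bsdp_of_charIdeal_eq_span_kato_rankZero_odd`); (e) **a LOWER bound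
`ord_p #Ш_an ≤ ord_p #Ш[p^∞]` ⟹ `BSD(E,p)` ∧ MC(pair) ∧ `ℓ = 1`**
(`…bsdp_and_charIdeal_eq_span_kato_of_shaAn_le_card_rankZero_odd`) — the socket into which part 3's
native `p`-descent certificate (`Sel^(p)(E/ℚ) ≠ 0` on the `ord_p #Ш_an = 2` rows) plugs; and the `p = 3`
instances with the binder discharged by `mainTheorem_three` (§2). Census pointer (EVIDENCE; nothing
booked): the five rank-0 (G-ord, `e = 2`) × X4 × surj(3) window rows with `3 ∣ #Ш_an` (3555e1, 14976k1,
16074b1, 16830p1 with `#Ш_an = 9`; 19215t1 with `81`) are (e)'s rows at `p = 3`.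

References: Kato 2004 Thm. 17.4 (3) [Kato2004Asterisque]; Delbourgo 2002 Thm. (A), (B) [Delbourgo2002];
Wuthrich 2014 Lemma 20 [Wuthrich2014]; Greenberg–Vatsal 2000 p. 4 [GreenbergVatsal2000]; Miller 2011
Def. 1.1 [Miller2011LMS]; gen 32 part 6; gen 33 part 1. -/

set_option autoImplicit false

noncomputable section

open scoped Classical MatrixGroups ModularForm NumberField

open CongruenceSubgroup IsDedekindDomain WeierstrassCurve NumberField
  Literature.NumberTheory.EllipticCurves
  Literature.NumberTheory.EllipticCurves.ModularForms
  Literature.NumberTheory.EllipticCurves.Rank1Residual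
  Literature.NumberTheory.EllipticCurves.Rank1Residual.Typed
  Literature.NumberTheory.EllipticCurves.Delbourgo2002
  Literature.NumberTheory.GaloisRepresentations
  Summit.BirchSwinnertonDyer.Rank1Residual.AdditivePotMult
  Summit.BirchSwinnertonDyer.Rank1Residual.X1.MuLambda
  Summit.BirchSwinnertonDyer.Rank1Residual.X1.RankOneParitySqueeze
  Summit.BirchSwinnertonDyer.Rank1Residual.X11a.LambdaNorm

namespace Summit.BirchSwinnertonDyer.Rank1Residual.Additive

/-! ### §1 `BSD(E,p)` versus the main conjecture at the pair, every odd `p` -/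

section Converse

open TameBranchMuPart TameBranchAnalyticSha

variable {W : WeierstrassCurve ℚ} [W.IsElliptic] [W.IsGloballyMinimal] {p : ℕ} [hp : Fact p.Prime]

/-- **(c) `BSD(E,p)` ⟹ THE MAIN CONJECTURE AT THE PAIR AND `ℓ = 1`, every odd `p`.** IF Miller's `BSD(E,p)`
holds, then for the twist datum and every cyclotomic datum the Kato element `g` generates `char_Λ X(E/ℚ_∞)`
and every `(u', ℓ')` fitting clause 3 of (B) for `g` has `ℓ' = 1` (anomalous or not). `BSD(E,p)` is a
HYPOTHESIS; nothing booked. [cite: Kato2004Asterisque, Thm. 17.4 (3) (p. 273)]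
[cite: Delbourgo2002, Theorem (B) (p. 40)] [cite: Miller2011LMS, Def. 1.1 (arXiv:1010.2431 p. 3)] -/
theorem ClassX4Gord.charIdeal_eq_span_kato_of_bsdp_rankZero_odd
    (hK : Wuthrich2014.kato_halfEigenCharIdeal_dvd_cyclotomicPrime_of_surjective)
    (hGZK : rank_eq_analyticRank_of_analyticRank_le_one) (hmod : hasEntireLFunction_rat)
    (hX : ClassX4Gord W p) (hsurj : Surj W p) (hr : W.analyticRank = 0) (hBSD : BSDp W p)
    {Dh : PAdicHeightData W p} (hBcl : LeadingTermClauses W p Dh)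
    (V : WeierstrassCurve ℚ) [V.IsElliptic] [V.IsGloballyMinimal] (C : VariableChange ℚ)
    (hC : C • V.quadraticTwist ((-1 : ℚ) ^ (p / 2) * p) = W) (hV : GoodOrd V p)
    {N : ℕ} [NeZero N] {f : CuspForm (Gamma0 N) 2} (hf : IsNewformOf V f)
    (ϖ : ℚ) (hϖ : if Even (p / 2) then (ϖ : ℝ) * V.realPeriodRat = plusPeriod f
      else (ϖ : ℝ) * V.imaginaryPeriodRat = minusPeriod f)
    {κ : ZpExtension ℚ p} {γ : Field.absoluteGaloisGroup ℚ}
    (hκ : κ.IsCyclotomic) (hγ : κ.IsTopGenerator γ) (hγ' : IsCyclotomicVariable p γ)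
    (D : W.SelmerDualData κ γ) :
    ∃ (g : IwasawaAlgebra p) (u : ℤ_[p]ˣ), D.charIdeal = Ideal.span {g} ∧
      iwasawaToPowerSeries p g = PowerSeries.C (((u : ℤ_[p]) : ℚ_[p]) * (ϖ : ℚ_[p])) *
        (if Even (p / 2) then padicLFunctionBranch f ((unitRoot V p : ℤ_[p]) : ℚ_[p]) (p / 2)
          else padicLFunctionMinusBranch f ((unitRoot V p : ℤ_[p]) : ℚ_[p]) (p / 2)) ∧
      ∀ (u' : ℤ_[p]ˣ) (ℓ' : ℕ), ℓ' ∣ p ^ 2 →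
        ((PowerSeries.coeff W.mordellWeilRank g : ℤ_[p]) : ℚ_[p]) *
            padicLog p (cyclotomicGenerator p) ^ W.mordellWeilRank * (W.torsionOrder : ℚ_[p]) ^ 2 =
          ((u' : ℤ_[p]) : ℚ_[p]) * (ℓ' : ℚ_[p]) *
            ((Nat.card (AddCommGroup.primaryComponent W.sha p) : ℚ_[p]) *
              padicRegulator Dh * W.tamagawaProduct) → ℓ' = 1 := by
  have hp2 : p ≠ 2 := hX.addv.1
  obtain ⟨hmw, -, s, hs, hsv⟩ := hBSD
  have hr0 : W.mordellWeilRank = 0 := by rw [hmw, hr]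
  obtain ⟨-, hfin, g, u, ℓ, -, hι, hvg, -, -, hle, hiff⟩ :=
    hX.padicVal_sha_add_le_shaAn_and_iff_rankZero_odd hK hGZK hmod hsurj hr hBcl hs V C hC hV hf ϖ hϖ hκ hγ hγ' D
  haveI := hfin
  haveI : Finite W.toAffine.Point := W.mordellWeilRank_eq_zero_iff_finite.mp hr0
  have hℓ0 : (padicValNat p ℓ : ℤ) = 0 := by
    have h0 : (0 : ℤ) ≤ padicValNat p ℓ := by exact_mod_cast Nat.zero_le _
    rw [hsv] at hle; linarith
  refine ⟨g, u, hiff.mpr (by rw [hsv, hℓ0, add_zero]), hι, fun u' ℓ' hℓ'p heq ↦ ?_⟩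
  have hℓ'0 : ℓ' ≠ 0 := by
    rintro rfl
    exact hp.out.ne_zero (pow_eq_zero_iff (n := 2) (by norm_num) |>.mp (zero_dvd_iff.mp hℓ'p))
  have hReg1 : padicRegulator Dh = 1 := padicRegulator_eq_one_of_finite W p Dh
  have hS0 : Nat.card (AddCommGroup.primaryComponent W.sha p) ≠ 0 :=
    (Nat.card_pos (α := AddCommGroup.primaryComponent W.sha p)).ne'
  rw [hr0, PowerSeries.coeff_zero_eq_constantCoeff] at heq
  have hg0c : ((PowerSeries.constantCoeff g : ℤ_[p]) : ℚ_[p]) ≠ 0 := by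
    intro e
    rw [e, zero_mul, zero_mul] at heq
    have hc : (W.tamagawaProduct : ℚ_[p]) ≠ 0 := by
      exact_mod_cast (W.tamagawaProduct_pos_holds : 0 < W.tamagawaProduct).ne'
    refine (mul_ne_zero (mul_ne_zero (coe_units_ne_zero p u') (by exact_mod_cast hℓ'0))
      (mul_ne_zero (mul_ne_zero (by exact_mod_cast hS0) (by rw [hReg1]; exact one_ne_zero)) hc)) heq.symm
  have hval := TameBranchFullSqueeze.valuation_eq_of_clause_three (W := W) hp2 hg0c
    (by rw [hReg1]; exact one_ne_zero) hℓ'0 hS0 heq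
  rw [hReg1, Padic.valuation_one] at hval
  simp only [Nat.cast_zero, add_zero] at hval
  have hℓ'v : (padicValNat p ℓ' : ℤ) = 0 := by
    have h0 : (0 : ℤ) ≤ padicValNat p ℓ' := by exact_mod_cast Nat.zero_le _
    linarith
  exact TameBranchFullSqueeze.eq_one_of_dvd_prime_sq_of_padicValNat_eq_zero hℓ'p (by exact_mod_cast hℓ'v)

/-- **(d) OFF THE ANOMALOUS ROWS, THE MAIN CONJECTURE AT THE PAIR ⟹ `BSD(E,p)`, every odd `p`.** IF for
one twist datum and every cyclotomic dual datum every Kato-shaped element (`g ∈ char_Λ X`, `ι g = u·ϖ·B^±`)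
generates `char_Λ X(E/ℚ_∞)`, then Miller's `BSD(E,p)` holds. [cite: Kato2004Asterisque, Thm. 17.4 (3) (p. 273)]
[cite: Delbourgo2002, Theorem (B) (p. 40)] [cite: Miller2011LMS, Def. 1.1 (arXiv:1010.2431 p. 3)] -/
theorem ClassX4Gord.bsdp_of_charIdeal_eq_span_kato_rankZero_odd
    (hK : Wuthrich2014.kato_halfEigenCharIdeal_dvd_cyclotomicPrime_of_surjective)
    (hGZK : rank_eq_analyticRank_of_analyticRank_le_one) (hmod : hasEntireLFunction_rat)
    (hX : ClassX4Gord W p) (hsurj : Surj W p) (hr : W.analyticRank = 0) (hna : ReductionNonAnomalous W p)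
    {Dh : PAdicHeightData W p} (hBcl : LeadingTermClauses W p Dh) {s : ℚ} (hs : shaAn W = (s : ℂ))
    (V : WeierstrassCurve ℚ) [V.IsElliptic] [V.IsGloballyMinimal] (C : VariableChange ℚ)
    (hC : C • V.quadraticTwist ((-1 : ℚ) ^ (p / 2) * p) = W) (hV : GoodOrd V p)
    {N : ℕ} [NeZero N] {f : CuspForm (Gamma0 N) 2} (hf : IsNewformOf V f)
    (ϖ : ℚ) (hϖ : if Even (p / 2) then (ϖ : ℝ) * V.realPeriodRat = plusPeriod f
      else (ϖ : ℝ) * V.imaginaryPeriodRat = minusPeriod f)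
    (hMC : ∀ (κ : ZpExtension ℚ p) (γ : Field.absoluteGaloisGroup ℚ),
      κ.IsCyclotomic → κ.IsTopGenerator γ → IsCyclotomicVariable p γ → ∀ (D : W.SelmerDualData κ γ)
      (g : IwasawaAlgebra p) (u : ℤ_[p]ˣ), g ∈ D.charIdeal →
        iwasawaToPowerSeries p g = PowerSeries.C (((u : ℤ_[p]) : ℚ_[p]) * (ϖ : ℚ_[p])) *
          (if Even (p / 2) then padicLFunctionBranch f ((unitRoot V p : ℤ_[p]) : ℚ_[p]) (p / 2)
            else padicLFunctionMinusBranch f ((unitRoot V p : ℤ_[p]) : ℚ_[p]) (p / 2)) →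
        D.charIdeal = Ideal.span {g}) :
    BSDp W p := by
  obtain ⟨hmw, -⟩ := hGZK W (by rw [hr]; norm_num)
  obtain ⟨κ₀, γ₀, hκ₀, hγ₀, hγ₀', D₀, -, -⟩ := exists_cyclotomic_dualData_generator W p
  obtain ⟨-, hfin, g, u, ℓ, hg, hι, -, -, hℓ1, -, hiff⟩ :=
    hX.padicVal_sha_add_le_shaAn_and_iff_rankZero_odd hK hGZK hmod hsurj hr hBcl hs V C hC hV hf ϖ hϖ hκ₀ hγ₀
      hγ₀' D₀
  have heq := hiff.mp (hMC κ₀ γ₀ hκ₀ hγ₀ hγ₀' D₀ g u hg hι)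
  rw [hℓ1 hna, padicValNat_one_right, Nat.cast_zero, add_zero] at heq
  exact ⟨hmw, hfin, s, hs, heq.symm⟩

/-- **(e) A LOWER BOUND ON `#Ш(E)[p^∞]` IS THE CERTIFICATE WHERE `p ∣ #Ш_an`, every odd `p`.** IF
`ord_p #Ш_an(E) ≤ ord_p #Ш(E/ℚ)[p^∞]` (a `p`-descent / visibility certificate — part 3 of gen 33), then
**`BSD(E,p)`** and, for the twist datum and every cyclotomic datum, **the Kato element generates
`char_Λ X(E/ℚ_∞)`** with Delbourgo's `ℓ = 1`. [cite: Kato2004Asterisque, Thm. 17.4 (3) (p. 273)]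
[cite: Delbourgo2002, Theorem (B) (p. 40)] [cite: Miller2011LMS, Def. 1.1 (arXiv:1010.2431 p. 3)] -/
theorem ClassX4Gord.bsdp_and_charIdeal_eq_span_kato_of_shaAn_le_card_rankZero_odd
    (hK : Wuthrich2014.kato_halfEigenCharIdeal_dvd_cyclotomicPrime_of_surjective)
    (hGZK : rank_eq_analyticRank_of_analyticRank_le_one) (hmod : hasEntireLFunction_rat)
    (hX : ClassX4Gord W p) (hsurj : Surj W p) (hr : W.analyticRank = 0)
    {Dh : PAdicHeightData W p} (hBcl : LeadingTermClauses W p Dh) {s : ℚ} (hs : shaAn W = (s : ℂ))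
    (hlow : padicValRat p s ≤ padicValNat p (Nat.card (AddCommGroup.primaryComponent W.sha p)))
    (V : WeierstrassCurve ℚ) [V.IsElliptic] [V.IsGloballyMinimal] (C : VariableChange ℚ)
    (hC : C • V.quadraticTwist ((-1 : ℚ) ^ (p / 2) * p) = W) (hV : GoodOrd V p)
    {N : ℕ} [NeZero N] {f : CuspForm (Gamma0 N) 2} (hf : IsNewformOf V f)
    (ϖ : ℚ) (hϖ : if Even (p / 2) then (ϖ : ℝ) * V.realPeriodRat = plusPeriod f
      else (ϖ : ℝ) * V.imaginaryPeriodRat = minusPeriod f)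
    {κ : ZpExtension ℚ p} {γ : Field.absoluteGaloisGroup ℚ}
    (hκ : κ.IsCyclotomic) (hγ : κ.IsTopGenerator γ) (hγ' : IsCyclotomicVariable p γ)
    (D : W.SelmerDualData κ γ) :
    BSDp W p ∧ (padicValNat p (Nat.card (AddCommGroup.primaryComponent W.sha p)) : ℤ) = padicValRat p s ∧
      ∃ (g : IwasawaAlgebra p) (u : ℤ_[p]ˣ) (ℓ : ℕ), D.charIdeal = Ideal.span {g} ∧
        iwasawaToPowerSeries p g = PowerSeries.C (((u : ℤ_[p]) : ℚ_[p]) * (ϖ : ℚ_[p])) *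
          (if Even (p / 2) then padicLFunctionBranch f ((unitRoot V p : ℤ_[p]) : ℚ_[p]) (p / 2)
            else padicLFunctionMinusBranch f ((unitRoot V p : ℤ_[p]) : ℚ_[p]) (p / 2)) ∧
        ℓ ∣ p ^ 2 ∧ ℓ = 1 ∧
        (padicValNat p (Nat.card (AddCommGroup.primaryComponent W.sha p)) : ℤ) + padicValNat p ℓ =
          padicValRat p s := by
  obtain ⟨hmw, -⟩ := hGZK W (by rw [hr]; norm_num)
  obtain ⟨-, hfin, g, u, ℓ, -, hι, -, hℓp, -, hle, hiff⟩ :=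
    hX.padicVal_sha_add_le_shaAn_and_iff_rankZero_odd hK hGZK hmod hsurj hr hBcl hs V C hC hV hf ϖ hϖ hκ hγ hγ' D
  have h0 : (0 : ℤ) ≤ padicValNat p ℓ := by exact_mod_cast Nat.zero_le _
  have hℓ0 : padicValNat p ℓ = 0 := by
    have : (padicValNat p ℓ : ℤ) ≤ 0 := by linarith
    omega
  have hcardeq : (padicValNat p (Nat.card (AddCommGroup.primaryComponent W.sha p)) : ℤ) = padicValRat p s := by
    refine le_antisymm ?_ hlow
    have h := hle; rw [hℓ0, Nat.cast_zero, add_zero] at h; exact h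
  have heq : (padicValNat p (Nat.card (AddCommGroup.primaryComponent W.sha p)) : ℤ) + padicValNat p ℓ =
      padicValRat p s := by rw [hℓ0, Nat.cast_zero, add_zero]; exact hcardeq
  exact ⟨⟨hmw, hfin, s, hs, hcardeq.symm⟩, hcardeq, g, u, ℓ, hiff.mpr heq, hι, hℓp,
    TameBranchFullSqueeze.eq_one_of_dvd_prime_sq_of_padicValNat_eq_zero hℓp hℓ0, heq⟩

end Converse

/-! ### §2 `p = 3` instances (binder discharged by `mainTheorem_three`) -/

section Three

open TameBranchMuPart TameBranchAnalyticSha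

variable {W : WeierstrassCurve ℚ} [W.IsElliptic] [W.IsGloballyMinimal]

/-- At `p = 3` the defect of an X4♯(G-ord) pair is AUTOMATICALLY `2` (Kodaira `I₀*`; gen 10's
`semistabilityIndex_eq_two_of_typeG_three`: Tate's algorithm at `3` on a (G) pair), so the `e = 2`
hypothesis of parts 1–2 is discharged at `p = 3`. [cite: Delbourgo2002, Hypothesis second bullet (p. 39)] -/
theorem ClassX4Gord.semistabilityIndex_three [Fact (Nat.Prime 3)] (hX : ClassX4Gord W 3) :
    semistabilityIndex W 3 = 2 :=
  semistabilityIndex_eq_two_of_typeG_three W hX.typeGOrd.typeG hX.addv.2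

/-- **`p = 3`: A LOWER BOUND ON `#Ш(E)[3^∞]` IS THE CERTIFICATE WHERE `3 ∣ #Ш_an`.** X4♯(G-ord) ∩ `I₀*`
∩ {`ρ̄_{E,3}` onto}, non-CM, `ord_{s=1} L(E,s) = 0`, `#Ш_an(E) = s`; IF `ord_3 s ≤ ord_3 #Ш(E/ℚ)[3^∞]`
(e.g. from a `3`-descent, part 3), then **`BSD(E,3)`** and **`ord_3 #Ш[3^∞] = ord_3 s`** (and, per part 1's
master theorem, the Kato element generates `char_Λ X(E/ℚ_∞)` for every twist / cyclotomic datum).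
Inputs: Kato 17.4 (3), Delbourgo 2002 at `p = 3` (`hDel3`), GZK, modularity, BCDT (for the twist datum).
[cite: Kato2004Asterisque, Thm. 17.4 (3) (p. 273)] [cite: Delbourgo2002, Theorem (A), (B) (p. 40)]
[cite: Miller2011LMS, Def. 1.1 (arXiv:1010.2431 p. 3)] -/
theorem ClassX4Gord.bsdp_three_of_katoHalf_of_shaAn_le_card_rankZero [Fact (Nat.Prime 3)]
    (hK : Wuthrich2014.kato_halfEigenCharIdeal_dvd_cyclotomicPrime_of_surjective)
    (hmodD : nonempty_modularParametrizationData) (hDel3 : Delbourgo2002.mainTheorem_three)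
    (hGZK : rank_eq_analyticRank_of_analyticRank_le_one) (hmod : hasEntireLFunction_rat)
    (hX : ClassX4Gord W 3) (hcm : ¬ W.HasCM) (hsurj : Surj W 3)
    (hr : W.analyticRank = 0) {s : ℚ} (hs : shaAn W = (s : ℂ))
    (hlow : padicValRat 3 s ≤ padicValNat 3 (Nat.card (AddCommGroup.primaryComponent W.sha 3))) :
    BSDp W 3 ∧ (padicValNat 3 (Nat.card (AddCommGroup.primaryComponent W.sha 3)) : ℤ) = padicValRat 3 s := by
  have he := hX.semistabilityIndex_three
  obtain ⟨Dh, hBcl⟩ := hX.exists_leadingTermClauses_three hDel3 hcm he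
  obtain ⟨V, iV, iVm, C, hV, hC⟩ := hX.exists_goodOrd_pStar_twist_model W 3 he
  haveI : NeZero (V.conductorNorm ℤ) := ⟨(V.conductorNorm_pos_holds).ne'⟩
  obtain ⟨Dm⟩ := hmodD V
  obtain ⟨ϖ, hϖ⟩ := exists_periodRatio_parity (p := 3) V Dm
  obtain ⟨κ₀, γ₀, hκ₀, hγ₀, hγ₀', D₀, -, -⟩ := exists_cyclotomic_dualData_generator W 3
  obtain ⟨hB, hcard, -⟩ := hX.bsdp_and_charIdeal_eq_span_kato_of_shaAn_le_card_rankZero_odd hK hGZK hmod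
    hsurj hr hBcl hs hlow V C hC hV Dm.isNewformOf ϖ hϖ hκ₀ hγ₀ hγ₀' D₀
  exact ⟨hB, hcard⟩

/-- **`p = 3`: `BSD(E,3)` ⟹ THE MAIN CONJECTURE AT THE PAIR AND `ℓ = 1`.** Same rows; IF `BSD(E,3)` holds,
then for every twist datum `(V, C, f, ϖ)` and every cyclotomic dual datum the Kato element generates
`char_Λ X(E/ℚ_∞)` — Delbourgo's (G)-main conjecture at the pair, integrally — for the (B)-datum of
`mainTheorem_three`. [cite: Kato2004Asterisque, Thm. 17.4 (3) (p. 273)]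
[cite: Delbourgo2002, Theorem (A), (B) (p. 40)] [cite: Miller2011LMS, Def. 1.1 (arXiv:1010.2431 p. 3)] -/
theorem ClassX4Gord.charIdeal_eq_span_kato_three_of_bsdp_rankZero [Fact (Nat.Prime 3)]
    (hK : Wuthrich2014.kato_halfEigenCharIdeal_dvd_cyclotomicPrime_of_surjective)
    (hDel3 : Delbourgo2002.mainTheorem_three)
    (hGZK : rank_eq_analyticRank_of_analyticRank_le_one) (hmod : hasEntireLFunction_rat)
    (hX : ClassX4Gord W 3) (hcm : ¬ W.HasCM) (hsurj : Surj W 3)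
    (hr : W.analyticRank = 0) (hBSD : BSDp W 3)
    (V : WeierstrassCurve ℚ) [V.IsElliptic] [V.IsGloballyMinimal] (C : VariableChange ℚ)
    (hC : C • V.quadraticTwist ((-1 : ℚ) ^ ((3 : ℕ) / 2) * (3 : ℕ)) = W) (hV : GoodOrd V 3)
    {N : ℕ} [NeZero N] {f : CuspForm (Gamma0 N) 2} (hf : IsNewformOf V f)
    (ϖ : ℚ) (hϖ : if Even ((3 : ℕ) / 2) then (ϖ : ℝ) * V.realPeriodRat = plusPeriod f
      else (ϖ : ℝ) * V.imaginaryPeriodRat = minusPeriod f)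
    {κ : ZpExtension ℚ 3} {γ : Field.absoluteGaloisGroup ℚ}
    (hκ : κ.IsCyclotomic) (hγ : κ.IsTopGenerator γ) (hγ' : IsCyclotomicVariable 3 γ)
    (D : W.SelmerDualData κ γ) :
    ∃ (g : IwasawaAlgebra 3) (u : ℤ_[3]ˣ), D.charIdeal = Ideal.span {g} ∧
      iwasawaToPowerSeries 3 g = PowerSeries.C (((u : ℤ_[3]) : ℚ_[3]) * (ϖ : ℚ_[3])) *
        (if Even ((3 : ℕ) / 2) then padicLFunctionBranch f ((unitRoot V 3 : ℤ_[3]) : ℚ_[3]) ((3 : ℕ) / 2)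
          else padicLFunctionMinusBranch f ((unitRoot V 3 : ℤ_[3]) : ℚ_[3]) ((3 : ℕ) / 2)) := by
  obtain ⟨Dh, hBcl⟩ := hX.exists_leadingTermClauses_three hDel3 hcm hX.semistabilityIndex_three
  obtain ⟨g, u, hspan, hι, -⟩ := hX.charIdeal_eq_span_kato_of_bsdp_rankZero_odd hK hGZK hmod hsurj hr hBSD
    hBcl V C hC hV hf ϖ hϖ hκ hγ hγ' D
  exact ⟨g, u, hspan, hι⟩

end Three

end Summit.BirchSwinnertonDyer.Rank1Residual.Additive

end
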